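import Literature.Geometry.Lorentzian.FinalState
import Literature.Geometry.Lorentzian.CauchyDevelopment
import HarnessLib

/-!
# Named fact: an admissible vacuum datum with a FLAT maximal Cauchy development has mass
# parameter zero (`FlatEndMassZero`)

Layer `Literature/Geometry/Lorentzian` (family `gr`, summit `FinalStateConjecture`). Port of the
porting stub **F — `FlatEndMassZero`** of the decomposition cell `decomp-fsc` (lens-2 g6 kernel
`SolitonCarve.lean`), requested by work item `wi-97235` («port: FlatEndMassZero», for
`stmt-FinalStateConjecture-29358` `BreatherDispersiveExit` and the strictly-stationary sub-cell of
`stmt-29357`): the statement is ported VERBATIM from the kernel (same binders, same body) over the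
tree carriers `admissibleVacuumData` (`FinalState.lean`), `VacuumCauchyDevelopment`,
`VacuumCauchyDevelopment.IsMaximal` (`CauchyDevelopment.lean`), `CovariantDerivative.IsFlat`
(`Curvature.lean`), `AFEnd.IsSoleEnd`, `AFEnd.IsStronglyAsymptoticallyFlatDR`
(`AsymptoticFlatness.lean`), and is consumed at exactly this shape by the kernel's certificates
`not_breather_exceptional` / `not_strictlyStationary_exceptional`
(`F → ZeroMassAdmissibleMinkowskian (stmt-18053) → MinkowskiCauchyDataSettle → exit`).

## The statement and why it is a theorem of the literature

`FlatEndMassZero`: for Christodoulou-admissible vacuum data `d = (h, k)` on the connected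
`3`-manifold `X` (complete, vacuum constraints, ONE end `e`, `h = (1 + 2M/r) δ + o₂(r⁻¹)`,
`k = o₁(r⁻²)` on `e` for some mass parameter `M`), if SOME maximal vacuum Cauchy development of `d`
is flat (`Riem(g) = 0`), then `d` has a sole end on which it is DR-strongly asymptotically flat
with mass parameter `0`. Proof in print (three published steps; the composite is the folklore
«an asymptotically flat hypersurface in Minkowski space-time has zero ADM energy–momentum»):

1. *The mass parameter is the ADM energy.* For `h = (1 + 2M/r) δ + o₂(r⁻¹)` the ADM energy
   fluxes `E(r) = (16π)⁻¹ ∮_{S_r} (∂ⱼ h_ij − ∂ᵢ h_jj) xⁱ/r` converge to `M` — PROVED in the tree: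
   `AFEnd.IsStronglyAsymptoticallyFlatDR.hasADMEnergy` (`StronglyAsymptoticallyFlatADMEnergy.lean`,
   not imported here to keep this statement file light; Bartnik 1986, (4.2); Dafermos–Rodnianski
   2013, App. B.2.3). So it suffices that the ADM energy of `e` VANISHES; this reduction is proved
   below (`FlatEndMassZero.of_hasADMEnergy_zero`, uniqueness of limits).
2. *A flat globally hyperbolic development of the (simply connected) far region develops
   isometrically into Minkowski space-time* `(ℝ⁴, η)` (developing map of a flat connection; the
   tree's `FlatGeodesicChart.lean` / `FlatDevelopment.lean` give the isometric charts in which `g`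
   is the constant form `g_p`; O'Neill 1983, Ch. 8), so in Minkowskian coordinates `y^μ` the far
   region of `(X, h, k)` is a spacelike hypersurface of Minkowski space-time with induced data
   `(h, k)`, while the data's own end chart `x^i` together with the development's time function
   furnishes asymptotically Minkowskian coordinates `x^μ` in which `g_μν − η_μν = O(r⁻¹)`.
3. *The ADM energy–momentum four-vector of an asymptotically flat end of order `> 1/2` is a
   geometric invariant of the ambient space-time*: it is finite and independent of the spheres
   used (Chruściel 1986, Thm. 1, held text `paper:arxiv-1312.0254` p0004: «m and P_i are finite,
   independent upon the particular family of spheres S(R) chosen»), independent of the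
   asymptotically flat chart on a fixed hypersurface (ibid., Thm. 2; Bartnik 1986, Thm. 4.2 for the
   mass), and Lorentz-covariant under changes of asymptotically Minkowskian coordinate systems in
   boost-type domains — Chruściel, *On the invariant mass conjecture in general relativity*, CMP 120
   (1988) [paywalled here, acquisition `acq-14875`; restated in the held secondary Cederbaum–Metzger
   2026, arXiv:2604.07168, Remark 1 (p0003): «it was shown by Chruściel [CMP 1988] that the
   energy-momentum 4-vector (E, P⃗)ᵗ is a geometric invariant of the ambient spacetime for τ > 1/2
   …, with Lorentz transformations replacing rotations»]. In the standard slicing of Minkowski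
   space-time `(E, P⃗) = 0`; hence `(E, P⃗) = 0` for the far region of `(X, h, k)` in its own chart,
   `E = 0`, and by 1. `M = 0`.

(The converse direction — `E = 0` forces the data to embed in Minkowski space-time — is the rigid
positive energy theorem, Beig–Chruściel 1996, Thm. 4.1 (held text `paper:arxiv-gr-qc_9510015`
p0012); it is NOT used here and is the business of `stmt-18053`.)

Faithfulness notes. (α) VERBATIM port: binders `(X : Type) [TopologicalSpace X] [ChartedSpace E3 X]
[IsManifold (𝓡 3) ∞ X] [T2Space X] [SecondCountableTopology X] [ConnectedSpace X]`,
`d ∈ admissibleVacuumData X`, flatness hypothesis `∃ 𝒟 : VacuumCauchyDevelopment d, 𝒟.IsMaximal ∧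
∀ [𝒟.metric.HasLeviCivita], 𝒟.metric.leviCivita.IsFlat` (the tree's standing-hypothesis idiom for
the Levi-Civita connection, as in `admissibleVacuumData` and `VacuumCauchyDevelopment.isRicciFlat`),
conclusion `∃ e : AFEnd X, e.IsSoleEnd ∧ e.IsStronglyAsymptoticallyFlatDR d 0`. (β) Maximality of
`𝒟` is not needed by the printed argument (any flat vacuum Cauchy development of `d` contains the
domain of dependence of the far region); it is kept because the consumer supplies it. (γ) ONE named
fact (`FlatEndMassZero`); everything else is PROVED: the unpacking `FlatEndMassZero.apply`, the
REDUCTIONS `FlatEndMassZero.of_hasADMEnergy_zero` (the fact follows from step 1 and the analytic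
core «flat MGHD ⇒ the ADM energy of every sole DR end vanishes» by uniqueness of limits — both
inputs are HYPOTHESES of that theorem, not further named facts) and
`FlatEndMassZero.of_forall_eq_zero`, and the consequence `FlatEndMassZero.exists_hasADMEnergy_zero`
(`E = 0` on the witness end, every DR mass parameter there is `0`). No `sorry`, no `instance`, no notation. Grade: REFEREED (steps 1–3);
the composite is folklore. Nothing here asserts the final state conjecture or any of its cruxes.

## References
* [Chrusciel1988] P. T. Chruściel, *On the invariant mass conjecture in general relativity*,
  Commun. Math. Phys. 120 (1988) 233–248 — Lorentz covariance / geometric invariance of the ADM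
  four-momentum (boost-type domains, order `> 1/2`).
* [CederbaumMetzger2026] C. Cederbaum, J. Metzger, *Geometrically defined asymptotic coordinates in
  General Relativity*, arXiv:2604.07168, Remark 1 (secondary restatement of [Chrusciel1988]).
* [Chrusciel1986Boundary] P. T. Chruściel, *Boundary conditions at spatial infinity from a
  Hamiltonian point of view* (1986; arXiv:1312.0254), Thms. 1–2.
* [Bartnik1986] R. Bartnik, *The mass of an asymptotically flat manifold*, CPAM 39 (1986), (4.2),
  Thm. 4.2.
* [BeigChrusciel1996] R. Beig, P. T. Chruściel, *Killing vectors in asymptotically flat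
  space-times I*, J. Math. Phys. 37 (1996), Thm. 4.1 (rigid positive energy theorem; context only).
* [ONeill1983] B. O'Neill, *Semi-Riemannian Geometry*, Ch. 8 (flat space forms, developing map).
* [Christodoulou1999] D. Christodoulou, CQG 16 (1999) A23, p. A24 (the admissible class);
  [DafermosRodnianski2013] App. B.2.3 (DR-strong asymptotic flatness).
* Tree: `FinalState` (`admissibleVacuumData`, `exists_isSoleEnd_of_mem_admissibleVacuumData`),
  `CauchyDevelopment` (`VacuumCauchyDevelopment`, `.IsMaximal`), `Curvature` (`IsFlat`),
  `AsymptoticFlatness` (`AFEnd.IsSoleEnd`, `IsStronglyAsymptoticallyFlatDR`, `HasADMEnergy`,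
  `HasADMEnergy.admEnergy_eq`); `StronglyAsymptoticallyFlatADMEnergy`
  (`IsStronglyAsymptoticallyFlatDR.hasADMEnergy`, cited, not imported).
-/

open Set Filter Topology
open scoped Manifold ContDiff

namespace Literature.Geometry.Lorentzian

/-- **F — a flat maximal Cauchy development forces mass parameter `0`.** For every connected
`3`-manifold `X` and every Christodoulou-admissible vacuum datum `d` on `X` (complete, vacuum
constraints, one DR-strongly asymptotically flat end): if some maximal vacuum Cauchy development
of `d` is FLAT, then `d` has a sole end on which it is DR-strongly asymptotically flat with mass
parameter `0` (`h = δ + o₂(r⁻¹)`, `k = o₁(r⁻²)`). In print: the far region develops isometrically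
into Minkowski space-time, where the data are those of an asymptotically flat spacelike
hypersurface; the ADM energy–momentum of an asymptotically flat end of order `> 1/2` is a
geometric invariant of the ambient space-time (Lorentz-covariant under change of asymptotically
Minkowskian coordinates), hence equal to its value `0` in the standard slicing; and the DR mass
parameter equals the ADM energy (tree `IsStronglyAsymptoticallyFlatDR.hasADMEnergy`), so it is `0`.
Ported verbatim from the `decomp-fsc` kernel stub `FlatEndMassZero` (wi-97235).
[cite: Chrusciel1988, main theorem (Lorentz covariance of the ADM four-momentum)]
[cite: CederbaumMetzger2026, Remark 1] [cite: Chrusciel1986Boundary, Thms. 1–2]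
[cite: Bartnik1986, Thm. 4.2] [cite: ONeill1983, Ch. 8] -/
def FlatEndMassZero : Prop :=
  ∀ (X : Type) [TopologicalSpace X] [ChartedSpace E3 X] [IsManifold (𝓡 3) ((⊤ : ℕ∞) : WithTop ℕ∞) X]
    [T2Space X] [SecondCountableTopology X] [ConnectedSpace X],
    ∀ d ∈ admissibleVacuumData X,
      (∃ 𝒟 : VacuumCauchyDevelopment d, 𝒟.IsMaximal ∧ ∀ [𝒟.metric.HasLeviCivita], 𝒟.metric.leviCivita.IsFlat) →
        ∃ e : AFEnd X, e.IsSoleEnd ∧ e.IsStronglyAsymptoticallyFlatDR d 0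

namespace FlatEndMassZero

variable {X : Type} [TopologicalSpace X] [ChartedSpace E3 X] [IsManifold (𝓡 3) ∞ X]
  [T2Space X] [SecondCountableTopology X] [ConnectedSpace X]

/-- Unpacking `FlatEndMassZero` at an admissible datum with a flat maximal vacuum Cauchy
development. [cite: Chrusciel1988, main theorem] -/
theorem apply (h : FlatEndMassZero) {d : InitialDataSet (𝓡 3) X} (hd : d ∈ admissibleVacuumData X)
    (hflat : ∃ 𝒟 : VacuumCauchyDevelopment d,
      𝒟.IsMaximal ∧ ∀ [𝒟.metric.HasLeviCivita], 𝒟.metric.leviCivita.IsFlat) :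
    ∃ e : AFEnd X, e.IsSoleEnd ∧ e.IsStronglyAsymptoticallyFlatDR d 0 :=
  h X d hd hflat

/-- **Reduction to the analytic core.** `FlatEndMassZero` follows from the two printed analytic
inputs, taken here as HYPOTHESES (they are not vendored as further named facts): (1) the DR mass
parameter is the ADM energy — `h = (1 + 2M/r) δ + o₂(r⁻¹)` gives ADM energy fluxes converging to `M`
(PROVED in the tree as `AFEnd.IsStronglyAsymptoticallyFlatDR.hasADMEnergy`,
`StronglyAsymptoticallyFlatADMEnergy.lean`, which is the intended argument for `hmass`; Bartnik 1986,
(4.2)); (2) the core «if an admissible datum has a flat maximal vacuum Cauchy development, then the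
ADM energy of each of its sole DR-strongly asymptotically flat ends vanishes» (developing map into
Minkowski space-time + geometric invariance of the ADM four-momentum, Chruściel 1988). Then
`M = E = 0` by uniqueness of limits (`HasADMEnergy.admEnergy_eq`).
[cite: Chrusciel1988, main theorem] [cite: Bartnik1986, (4.2), Thm. 4.2] -/
theorem of_hasADMEnergy_zero
    (hmass : ∀ (X : Type) [TopologicalSpace X] [ChartedSpace E3 X]
      [IsManifold (𝓡 3) ((⊤ : ℕ∞) : WithTop ℕ∞) X] (e : AFEnd X) (d : InitialDataSet (𝓡 3) X) (M : ℝ),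
      e.IsStronglyAsymptoticallyFlatDR d M → e.HasADMEnergy d M)
    (hcore : ∀ (X : Type) [TopologicalSpace X] [ChartedSpace E3 X]
      [IsManifold (𝓡 3) ((⊤ : ℕ∞) : WithTop ℕ∞) X] [T2Space X] [SecondCountableTopology X]
      [ConnectedSpace X], ∀ d ∈ admissibleVacuumData X,
      (∃ 𝒟 : VacuumCauchyDevelopment d,
          𝒟.IsMaximal ∧ ∀ [𝒟.metric.HasLeviCivita], 𝒟.metric.leviCivita.IsFlat) →
        ∀ (e : AFEnd X) (M : ℝ), e.IsSoleEnd → e.IsStronglyAsymptoticallyFlatDR d M →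
          e.HasADMEnergy d 0) :
    FlatEndMassZero := by
  intro X _ _ _ _ _ _ d hd hflat
  obtain ⟨e, hsole, M, hM⟩ := exists_isSoleEnd_of_mem_admissibleVacuumData hd
  have hEM : e.admEnergy d = M := (hmass X e d M hM).admEnergy_eq
  have hE0 : e.admEnergy d = 0 := (hcore X d hd hflat e M hsole hM).admEnergy_eq
  have hM0 : M = 0 := hEM.symm.trans hE0
  exact ⟨e, hsole, hM0 ▸ hM⟩

/-- **Purely logical form of the reduction**: `FlatEndMassZero` follows from «for an admissible
datum with a flat maximal vacuum Cauchy development, every DR mass parameter of every sole end is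
`0`» (= steps 1–3 of the printed proof combined), since admissibility provides a sole DR end with
SOME parameter. [cite: Chrusciel1988, main theorem] [cite: Christodoulou1999, p. A24] -/
theorem of_forall_eq_zero
    (hzero : ∀ (X : Type) [TopologicalSpace X] [ChartedSpace E3 X]
      [IsManifold (𝓡 3) ((⊤ : ℕ∞) : WithTop ℕ∞) X] [T2Space X] [SecondCountableTopology X]
      [ConnectedSpace X], ∀ d ∈ admissibleVacuumData X,
      (∃ 𝒟 : VacuumCauchyDevelopment d,
          𝒟.IsMaximal ∧ ∀ [𝒟.metric.HasLeviCivita], 𝒟.metric.leviCivita.IsFlat) →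
        ∀ (e : AFEnd X) (M : ℝ), e.IsSoleEnd → e.IsStronglyAsymptoticallyFlatDR d M → M = 0) :
    FlatEndMassZero := by
  intro X _ _ _ _ _ _ d hd hflat
  obtain ⟨e, hsole, M, hM⟩ := exists_isSoleEnd_of_mem_admissibleVacuumData hd
  exact ⟨e, hsole, hzero X d hd hflat e M hsole hM ▸ hM⟩

/-- Under `FlatEndMassZero` and input (1) (mass parameter = ADM energy, tree
`IsStronglyAsymptoticallyFlatDR.hasADMEnergy`), an admissible datum with a flat maximal vacuum
Cauchy development has a sole end of **ADM energy `0`**, on which every DR mass parameter is `0`.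
[cite: Chrusciel1988, main theorem] [cite: Bartnik1986, (4.2), Thm. 4.2] -/
theorem exists_hasADMEnergy_zero (h : FlatEndMassZero)
    (hmass : ∀ (X : Type) [TopologicalSpace X] [ChartedSpace E3 X]
      [IsManifold (𝓡 3) ((⊤ : ℕ∞) : WithTop ℕ∞) X] (e : AFEnd X) (d : InitialDataSet (𝓡 3) X) (M : ℝ),
      e.IsStronglyAsymptoticallyFlatDR d M → e.HasADMEnergy d M)
    {d : InitialDataSet (𝓡 3) X} (hd : d ∈ admissibleVacuumData X)
    (hflat : ∃ 𝒟 : VacuumCauchyDevelopment d,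
      𝒟.IsMaximal ∧ ∀ [𝒟.metric.HasLeviCivita], 𝒟.metric.leviCivita.IsFlat) :
    ∃ e : AFEnd X, e.IsSoleEnd ∧ e.IsStronglyAsymptoticallyFlatDR d 0 ∧ e.HasADMEnergy d 0 ∧
      ∀ M : ℝ, e.IsStronglyAsymptoticallyFlatDR d M → M = 0 := by
  obtain ⟨e, hsole, h0⟩ := h X d hd hflat
  refine ⟨e, hsole, h0, hmass X e d 0 h0, fun M hM ↦ ?_⟩
  exact (hmass X e d M hM).admEnergy_eq.symm.trans (hmass X e d 0 h0).admEnergy_eq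

end FlatEndMassZero

end Literature.Geometry.Lorentzian
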